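import Summits.BirchSwinnertonDyer.BirchSwinnertonDyer.Theorems.EisensteinPrimesMazurMCOnCellBOfNamedFacts
import Summits.BirchSwinnertonDyer.BirchSwinnertonDyer.Theorems.EisensteinPrimesMazurMCOnCellBTwistbackTwoStepShaUnit
import HarnessLib

/-!
# Crux 3 `MazurMCOnCellB` (stmt-BirchSwinnertonDyer-19033), line `twistback` v7 (sha256 0ee3d465…, REGISTERED 2026-08-28T20:30:46Z
# by LEAD x2-p1 g13): the crux BY NAME is a TREE theorem conditional on EXACTLY the v7 cone — `PublishedInputs` + EIGHT
# PUBLISHED named facts + Keller–Yin Thm. D (PRE) + the registered open stub 6″ `stub_upperPartnerOffSubrowNoUnitEnd`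

LEAD seat `bsd-line-x2-p1` g13 (2026-08-28; `--supports` stmt-BirchSwinnertonDyer-19033). THEOREMS ONLY: no `def`, no named
fact introduced, no `sorry`; every step is a by-name application of a landed tree theorem (width seats x2-p1-w3 g12 p664170,
x2-p1-w6 g2 p662647, x2-p1-w3 g11 p661280).

WHAT. The v7 skeleton (`Cruxes/MazurMCOnCellB/Lines/twistback.lean`, commit 4d8b7f75be40) narrows the line's one open stub from
v5/v6's 6′ `stub_upperPartnerOffSubrow` («(∃-PARTNER) at every X2b pair OFF the closed sub-row `p = 3` ∧ non-split ∧
balance-1 datum») to 6″ `stub_upperPartnerOffSubrowNoUnitEnd`: the SAME conclusion under ONE more negated hypothesis, the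
TWO-STEP Ш-UNIT DATUM of p662647 `…TwistbackTwoStepShaUnit.upperPartner_at_of_twoStepShaUnit` («∃ admissible `K` with
`r_an(E^{(d_K)}) = 1`, a minimal model `Wd` of the twist, a `K″` admissible for `Wd` with `L(Wd^{(d_{K″})},1) ≠ 0`, a minimal
model `W″` of the double twist, and `q : ℚ` with `shaAn W″ = q ∧ padicValRat p q = 0`»). Inside the skeleton the excluded
population is DERIVED (road (e)); this file re-runs that derivation on the Theorems side, over HYPOTHESES instead of
`sorry`-stubs, so that the tree — not only the crux workfile — carries the conditional theorem of record for v7: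

* §1 `upperPartnerOffSubrow_of_noUnitEnd` — the v6 stub 6′ (statement verbatim) FROM the v7 stub 6″ (statement verbatim,
  hypothesis `hNoUE`) + road (e)'s named facts: `PublishedInputs`, Wuthrich 2014 Prop. 21 (`sha_dvd_analyticSha`), Hsieh 2014,
  Liu–Zhang–Zhang 2018, Mazur 1978 Cor. 4.1 (PUBLISHED) and Keller–Yin Thm. D (PREPRINT); the two Poitou–Tate inputs of
  p662647 are the route-free tree theorems `SchneiderFreeAdditiveX3.PoitouTateReduction.poitouTate_{selmerStructure_duality,sha_tateDual}_holds`.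
  This is the kernel record «v7's registered content + road (e) ⟹ v6's registered content».
* §2 `mazurMCOnCellB_of_namedFacts_of_upperPartnerOffSubrowNoUnitEnd` — CRUX 3 BY NAME from EXACTLY the v7 cone:
  `PublishedInputs` (item -19037) + {Disegni 2020 Thm. 4(1), Mazur Cor. 4.1, Hsieh 2014, LZZ 2018 Thms. 1.5.1/1.5.3,
  Greenberg–Vatsal Thm. (3.11), Disegni 2020 Thm. 2.4, Nakagawa–Horie–Taya, Wuthrich 2014 Prop. 21} (EIGHT PUBLISHED named facts)
  + Keller–Yin Thm. D (PRE) + 6″ (verbatim, `hNoUE`) — §1 composed with x2-p1-w3 g12's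
  `…MazurMCOnCellBOfNamedFacts.mazurMCOnCellB_of_namedFacts_of_upperPartnerOffSubrow` (the v6 cone theorem). Of the NINE
  conjuncts of v7's `stub_printedFacts`, Bump–Friedberg–Hoffstein (2b) is the one NOT in this cone (it serves only the road
  stubs 4/5 ⟹ 6).

HONEST FRAMING: conditional theorems; the named facts enter exactly as labelled (PUBLISHED ×8 + the route's FACT item -19037;
Keller–Yin Thm. D is an UNREFEREED PREPRINT, arXiv:2402.12781v2 Thm. 5.1.3, flag `KYD-gap`); stub 6″ is OPEN as registered —
its excluded unit-end population is EXPECTED to be every X2b pair (idea-12 ANCHOR-CENSUS-g8: unit ends for 19/19 computed split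
classes `N ≤ 900`, 46/46 in rev 3) but is proved for NO infinite family (the unit-end supply of the `anchor` / `twistunit` lines
is open; nearest print Vatsal 1999/2005, Kriz–Li 2019, Byeon 2004 — none states it); no registered stub is closed by this file;
no summit statement, no Mazur main conjecture and no case of BSD is proved for any curve; 0 cells / labels / tiers move.

References: [KellerYin2024] Thm. D (PRE); [Wuthrich2014] Prop. 21, Thm. 16; [LiuZhangZhang2018] Thms. 1.5.1/1.5.3; [Hsieh2014]
Thm. A; [Mazur1978] Cor. 4.1; [Disegni2020] Thm. 2.4, Thm. 4; [GreenbergVatsal2000] Thm. (3.11); [NakagawaHorie1988] Thm. 1;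
[MilneADT2006] I Thm. 4.10; [CastellaEtAl2021] Thm. 5.3.1.
-/

set_option autoImplicit false

-- `Summit.BirchSwinnertonDyer.BirchSwinnertonDyer.…`: the summit and its single sub-problem share a name.
set_option linter.dupNamespace false

noncomputable section

open scoped Classical MatrixGroups ModularForm

open CongruenceSubgroup WeierstrassCurve NumberField IsDedekindDomain Field
  Literature.NumberTheory.GaloisRepresentations
  Literature.NumberTheory.GaloisCohomology
  Literature.NumberTheory.EllipticCurves
  Literature.NumberTheory.EllipticCurves.ModularForms
  Literature.NumberTheory.QuadraticFields
  Literature.NumberTheory.EllipticCurves.Rank1Residual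
  Literature.NumberTheory.EllipticCurves.Rank1Residual.Typed
  Literature.NumberTheory.EllipticCurves.Wuthrich2014
  Literature.NumberTheory.EllipticCurves.SteinWuthrich2013
  Literature.NumberTheory.EllipticCurves.GreenbergVatsal2000
  Literature.NumberTheory.EllipticCurves.Disegni2020
  Summit.BirchSwinnertonDyer.Rank1Residual
  Summit.BirchSwinnertonDyer.BirchSwinnertonDyer.Theses
  Summit.BirchSwinnertonDyer.BirchSwinnertonDyer.Theorems

namespace Summit.BirchSwinnertonDyer.BirchSwinnertonDyer.Theorems.EisensteinPrimesMazurMCOnCellBOfNamedFactsV7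

/-! ## §1. v7's registered stub 6″ + road (e) ⟹ v6's registered stub 6′ -/

/-- **The v6 registered open stub 6′ `stub_upperPartnerOffSubrow` (statement VERBATIM as the conclusion) from the v7 registered
open stub 6″ `stub_upperPartnerOffSubrowNoUnitEnd` (statement VERBATIM as the hypothesis `hNoUE`) and ROAD (e).** At an X2b
pair `(W, p)` off the closed sub-row: either a two-step Ш-unit datum exists — then width seat x2-p1-w6 g2's
`…TwistbackTwoStepShaUnit.upperPartner_at_of_twoStepShaUnit` (p662647) supplies the partner, for BOTH signs at `p`, from
`PublishedInputs` (`hP`), Wuthrich 2014 Prop. 21 (`hW21`), the two Poitou–Tate THEOREMS of the tree (route-free `_holds` of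
cell bsd-schneider, fed as terms), Hsieh 2014 (`hH`), Liu–Zhang–Zhang 2018 (`hF`), Mazur 1978 Cor. 4.1 (`hMaz`) and Keller–Yin
Thm. D (`hD`, PREPRINT) — or it does not, and 6″ applies. = the v7 skeleton's second excluded middle, on the Theorems side.
CONDITIONAL on every listed named fact and on the OPEN stub 6″; nothing about any curve is proved unconditionally.
[claim: KellerYin2024, status: under-review] [cite: KellerYin2024, Thm. D = Thm. 5.1.3 (arXiv:2402.12781v2 L306–L309)]
[cite: Wuthrich2014, Prop. 21 (p. 400)] [cite: LiuZhangZhang2018, Thm. 1.5.1 and Thm. 1.5.3] [cite: Hsieh2014, Thm. A (p. 712)]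
[cite: Mazur1978, Cor. 4.1] [cite: MilneADT2006, I Thm. 4.10] -/
theorem upperPartnerOffSubrow_of_noUnitEnd (hP : EisensteinPrimes.PublishedInputs) (hW21 : sha_dvd_analyticSha)
    (hH : hsieh2014_exists_anticyclotomicPAdicLFunction) (hF : LiuZhangZhang2018.thm151_thm153_modularCurve_heegnerVector)
    (hMaz : mazur_not_dvd_maninConstant_of_odd)
    (hD : KellerYin2024.thmD_imcMult_exists_isBDPLFunction_isTorsion_charIdeal_eq_OPEN)
    (hNoUE : ∀ (W : WeierstrassCurve ℚ) [W.IsElliptic] [W.IsGloballyMinimal] (p : ℕ) [Fact p.Prime],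
      X2.CellB W p →
      ¬ (p = 3 ∧ ¬ W.HasSplitMultiplicativeReductionAtPrime 3 ∧
          ∃ (Φ₀ : AddSubgroup (geomTorsion W (3 : ℤ))) (m : ℕ) (_ : NeZero m) (φ : DirichletCharacter (ZMod 3) m)
            (d : ℕ) (_ : NeZero d) (ψ : DirichletCharacter (ZMod 3) d) (S₀ : Finset (HeightOneSpectrum (𝓞 ℚ))),
            IsRationalLine W 3 Φ₀ ∧ φ.IsPrimitive ∧ ψ.IsPrimitive ∧
            (∀ (σ : absoluteGaloisGroup ℚ), ∀ P ∈ Φ₀,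
              σ • P = (φ ((modNCyclotomicCharacter ℚ m σ : (ZMod m)ˣ) : ZMod m)).val • P) ∧
            (∀ (σ : absoluteGaloisGroup ℚ) (P : geomTorsion W (3 : ℤ)),
              σ • P - (ψ ((modNCyclotomicCharacter ℚ d σ : (ZMod d)ˣ) : ZMod d)).val • P ∈ Φ₀) ∧
            (∀ v ∈ S₀, ((3 : ℕ) : 𝓞 ℚ) ∉ v.asIdeal) ∧
            (∀ v : HeightOneSpectrum (𝓞 ℚ), v ∉ S₀ → ((3 : ℕ) : 𝓞 ℚ) ∉ v.asIdeal → W.HasGoodReductionAt v) ∧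
            1 + ∑ v ∈ S₀, delta W 3 v =
              ∑ v ∈ S₀, ((if φ (Rat.HeightOneSpectrum.natGenerator v : ZMod m) =
                    (Rat.HeightOneSpectrum.natGenerator v : ZMod 3)
                  then sFactor 3 (Rat.HeightOneSpectrum.natGenerator v) else 0) +
                (if ψ (Rat.HeightOneSpectrum.natGenerator v : ZMod d) =
                    (Rat.HeightOneSpectrum.natGenerator v : ZMod 3)
                  then sFactor 3 (Rat.HeightOneSpectrum.natGenerator v) else 0))) →
      ¬ (∃ (K : Type) (_ : Field K) (_ : NumberField K), IsImaginaryQuadratic K ∧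
          SatisfiesHeegnerHypothesis (W.conductorNorm ℤ) K ∧ SatisfiesHeegnerHypothesis p K ∧
          Odd (NumberField.discr K) ∧ NumberField.discr K < -4 ∧
          (W.quadraticTwist (NumberField.discr K : ℚ)).analyticRank = 1 ∧
          ∃ (Wd : WeierstrassCurve ℚ) (_ : Wd.IsElliptic) (_ : Wd.IsGloballyMinimal),
            (∃ C : VariableChange ℚ, C • Wd = W.quadraticTwist (NumberField.discr K : ℚ)) ∧
            ∃ (K'' : Type) (_ : Field K'') (_ : NumberField K''), IsImaginaryQuadratic K'' ∧
              Odd (NumberField.discr K'') ∧ NumberField.discr K'' < -4 ∧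
              SatisfiesHeegnerHypothesis (Wd.conductorNorm ℤ) K'' ∧ SatisfiesHeegnerHypothesis p K'' ∧
              (Wd.quadraticTwist (NumberField.discr K'' : ℚ)).entireLFunction 1 ≠ 0 ∧
              ∃ (W'' : WeierstrassCurve ℚ) (_ : W''.IsElliptic) (_ : W''.IsGloballyMinimal),
                (∃ C : VariableChange ℚ, C • W'' = Wd.quadraticTwist (NumberField.discr K'' : ℚ)) ∧
                ∃ q : ℚ, shaAn W'' = (q : ℂ) ∧ padicValRat p q = 0) →
      ∃ (K : Type) (_ : Field K) (_ : NumberField K), IsImaginaryQuadratic K ∧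
        SatisfiesHeegnerHypothesis (W.conductorNorm ℤ) K ∧ SatisfiesHeegnerHypothesis p K ∧
        Odd (NumberField.discr K) ∧ NumberField.discr K < -4 ∧
        (W.quadraticTwist (NumberField.discr K : ℚ)).analyticRank = 1 ∧
        ∀ (Wd : WeierstrassCurve ℚ) [Wd.IsElliptic] [Wd.IsGloballyMinimal],
          (∃ C : VariableChange ℚ, C • Wd = W.quadraticTwist (NumberField.discr K : ℚ)) →
          MissingUpperBoundAt Wd p) :
    ∀ (W : WeierstrassCurve ℚ) [W.IsElliptic] [W.IsGloballyMinimal] (p : ℕ) [Fact p.Prime],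
    X2.CellB W p →
    ¬ (p = 3 ∧ ¬ W.HasSplitMultiplicativeReductionAtPrime 3 ∧
        ∃ (Φ₀ : AddSubgroup (geomTorsion W (3 : ℤ))) (m : ℕ) (_ : NeZero m) (φ : DirichletCharacter (ZMod 3) m)
        (d : ℕ) (_ : NeZero d) (ψ : DirichletCharacter (ZMod 3) d) (S₀ : Finset (HeightOneSpectrum (𝓞 ℚ))),
        IsRationalLine W 3 Φ₀ ∧ φ.IsPrimitive ∧ ψ.IsPrimitive ∧
        (∀ (σ : absoluteGaloisGroup ℚ), ∀ P ∈ Φ₀,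
          σ • P = (φ ((modNCyclotomicCharacter ℚ m σ : (ZMod m)ˣ) : ZMod m)).val • P) ∧
        (∀ (σ : absoluteGaloisGroup ℚ) (P : geomTorsion W (3 : ℤ)),
          σ • P - (ψ ((modNCyclotomicCharacter ℚ d σ : (ZMod d)ˣ) : ZMod d)).val • P ∈ Φ₀) ∧
        (∀ v ∈ S₀, ((3 : ℕ) : 𝓞 ℚ) ∉ v.asIdeal) ∧
        (∀ v : HeightOneSpectrum (𝓞 ℚ), v ∉ S₀ → ((3 : ℕ) : 𝓞 ℚ) ∉ v.asIdeal → W.HasGoodReductionAt v) ∧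
        1 + ∑ v ∈ S₀, delta W 3 v =
          ∑ v ∈ S₀, ((if φ (Rat.HeightOneSpectrum.natGenerator v : ZMod m) =
            (Rat.HeightOneSpectrum.natGenerator v : ZMod 3)
            then sFactor 3 (Rat.HeightOneSpectrum.natGenerator v) else 0) +
          (if ψ (Rat.HeightOneSpectrum.natGenerator v : ZMod d) =
            (Rat.HeightOneSpectrum.natGenerator v : ZMod 3)
            then sFactor 3 (Rat.HeightOneSpectrum.natGenerator v) else 0))) →
    ∃ (K : Type) (_ : Field K) (_ : NumberField K), IsImaginaryQuadratic K ∧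
      SatisfiesHeegnerHypothesis (W.conductorNorm ℤ) K ∧ SatisfiesHeegnerHypothesis p K ∧
      Odd (NumberField.discr K) ∧ NumberField.discr K < -4 ∧
      (W.quadraticTwist (NumberField.discr K : ℚ)).analyticRank = 1 ∧
      ∀ (Wd : WeierstrassCurve ℚ) [Wd.IsElliptic] [Wd.IsGloballyMinimal],
        (∃ C : VariableChange ℚ, C • Wd = W.quadraticTwist (NumberField.discr K : ℚ)) →
        MissingUpperBoundAt Wd p := by
  intro W _ _ p _ hc hsub
  by_cases he : (∃ (K : Type) (_ : Field K) (_ : NumberField K), IsImaginaryQuadratic K ∧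
      SatisfiesHeegnerHypothesis (W.conductorNorm ℤ) K ∧ SatisfiesHeegnerHypothesis p K ∧
      Odd (NumberField.discr K) ∧ NumberField.discr K < -4 ∧
      (W.quadraticTwist (NumberField.discr K : ℚ)).analyticRank = 1 ∧
      ∃ (Wd : WeierstrassCurve ℚ) (_ : Wd.IsElliptic) (_ : Wd.IsGloballyMinimal),
        (∃ C : VariableChange ℚ, C • Wd = W.quadraticTwist (NumberField.discr K : ℚ)) ∧
        ∃ (K'' : Type) (_ : Field K'') (_ : NumberField K''), IsImaginaryQuadratic K'' ∧
          Odd (NumberField.discr K'') ∧ NumberField.discr K'' < -4 ∧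
          SatisfiesHeegnerHypothesis (Wd.conductorNorm ℤ) K'' ∧ SatisfiesHeegnerHypothesis p K'' ∧
          (Wd.quadraticTwist (NumberField.discr K'' : ℚ)).entireLFunction 1 ≠ 0 ∧
          ∃ (W'' : WeierstrassCurve ℚ) (_ : W''.IsElliptic) (_ : W''.IsGloballyMinimal),
            (∃ C : VariableChange ℚ, C • W'' = Wd.quadraticTwist (NumberField.discr K'' : ℚ)) ∧
            ∃ q : ℚ, shaAn W'' = (q : ℂ) ∧ padicValRat p q = 0)
  · obtain ⟨K, _, _, hK, hHN, hHp, hoddK, hlt, hr1, Wd, _, _, hWd, K'', _, _, hK'', hodd'', hlt'', hHN'', hHp'', hL'',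
      W'', _, _, hW'', hunit⟩ := he
    exact EisensteinPrimesMazurMCOnCellBTwistbackTwoStepShaUnit.upperPartner_at_of_twoStepShaUnit hP hW21
      (fun K _ _ ↦ SchneiderFreeAdditiveX3.PoitouTateReduction.poitouTate_selmerStructure_duality_holds K)
      (fun K _ _ ↦ SchneiderFreeAdditiveX3.PoitouTateReduction.poitouTate_sha_tateDual_holds K) hH hF hMaz hD
      W p hc K hK hHN hHp hoddK hlt hr1 Wd hWd K'' hK'' hodd'' hlt'' hHN'' hHp'' hL'' W'' hW'' hunit
  · exact hNoUE W p hc hsub he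

/-! ## §2. Crux 3 BY NAME from exactly the v7 cone -/

/-- **CRUX 3 `MazurMCOnCellB` BY NAME FROM EXACTLY THE v7 CONE**: the route's FACT item `PublishedInputs` (stmt-…-19037, `hP`)
+ EIGHT PUBLISHED named facts — Disegni 2020 Thm. 4(1) (`hDis`), Mazur 1978 Cor. 4.1 (`hMaz`), Hsieh 2014 Thm. A (`hH`),
Liu–Zhang–Zhang 2018 Thms. 1.5.1/1.5.3 (`hF`), Greenberg–Vatsal 2000 Thm. (3.11) (`h311`), Disegni 2020 Thm. 2.4 (`hDGZ`),
Nakagawa–Horie 1988 + Taya 2000 (`hNHT`), Wuthrich 2014 Prop. 21 (`hW21`) — + Keller–Yin Thm. D (`hD`, UNREFEREED PREPRINT) +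
the REGISTERED OPEN STUB 6″ `stub_upperPartnerOffSubrowNoUnitEnd` of skeleton v7 (statement verbatim, `hNoUE`) ⟹ the crux
decl. Proof: §1 gives the v6 stub 6′, then x2-p1-w3 g12's v6-cone theorem
`…MazurMCOnCellBOfNamedFacts.mazurMCOnCellB_of_namedFacts_of_upperPartnerOffSubrow` (p664170: sub-row by Disegni 2.4 / GV 3.11
/ NH–Taya, STEP L by item -27489 from Thm. D + Hsieh + LZZ with Poitou–Tate discharged, composition p640326). = the v7
skeleton's `MazurMCOnCellB_of` with its `sorry`-stubs replaced by these hypotheses; conjunct (2b) BFH of `stub_printedFacts` is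
NOT in this cone. CONDITIONAL on the named facts exactly as labelled and on the OPEN stub 6″; no summit statement, no Mazur
MC, no BSD is proved for any curve by this. [claim: KellerYin2024, status: under-review]
[cite: KellerYin2024, Thm. D = Thm. 5.1.3 (arXiv:2402.12781v2 L306–L309)] [cite: Disegni2020, §2.2 Thm. 2.4 and §3.2 Thm. 4]
[cite: GreenbergVatsal2000, §3 Thm. (3.11)] [cite: Mazur1978, Cor. 4.1] [cite: LiuZhangZhang2018, Thm. 1.5.1 and Thm. 1.5.3]
[cite: Hsieh2014, Thm. A (p. 712)] [cite: NakagawaHorie1988, Thm. 1] [cite: Wuthrich2014, Prop. 21 (p. 400)] -/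
theorem mazurMCOnCellB_of_namedFacts_of_upperPartnerOffSubrowNoUnitEnd (hP : EisensteinPrimes.PublishedInputs)
    (hDis : padicBSD_rankOne_nonsplitMult) (hMaz : mazur_not_dvd_maninConstant_of_odd)
    (hH : hsieh2014_exists_anticyclotomicPAdicLFunction) (hF : LiuZhangZhang2018.thm151_thm153_modularCurve_heegnerVector)
    (h311 : thm311_hasUnitContent_iff_and_order_eq_of_lineRamifiedEven) (hDGZ : Disegni2020.padicGrossZagier_nonsplitMult)
    (hNHT : Literature.NumberTheory.QuadraticFields.nakagawaHorie_taya_exists_imaginary_h3_eq_one)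
    (hW21 : sha_dvd_analyticSha)
    (hD : KellerYin2024.thmD_imcMult_exists_isBDPLFunction_isTorsion_charIdeal_eq_OPEN)
    (hNoUE : ∀ (W : WeierstrassCurve ℚ) [W.IsElliptic] [W.IsGloballyMinimal] (p : ℕ) [Fact p.Prime],
      X2.CellB W p →
      ¬ (p = 3 ∧ ¬ W.HasSplitMultiplicativeReductionAtPrime 3 ∧
          ∃ (Φ₀ : AddSubgroup (geomTorsion W (3 : ℤ))) (m : ℕ) (_ : NeZero m) (φ : DirichletCharacter (ZMod 3) m)
            (d : ℕ) (_ : NeZero d) (ψ : DirichletCharacter (ZMod 3) d) (S₀ : Finset (HeightOneSpectrum (𝓞 ℚ))),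
            IsRationalLine W 3 Φ₀ ∧ φ.IsPrimitive ∧ ψ.IsPrimitive ∧
            (∀ (σ : absoluteGaloisGroup ℚ), ∀ P ∈ Φ₀,
              σ • P = (φ ((modNCyclotomicCharacter ℚ m σ : (ZMod m)ˣ) : ZMod m)).val • P) ∧
            (∀ (σ : absoluteGaloisGroup ℚ) (P : geomTorsion W (3 : ℤ)),
              σ • P - (ψ ((modNCyclotomicCharacter ℚ d σ : (ZMod d)ˣ) : ZMod d)).val • P ∈ Φ₀) ∧
            (∀ v ∈ S₀, ((3 : ℕ) : 𝓞 ℚ) ∉ v.asIdeal) ∧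
            (∀ v : HeightOneSpectrum (𝓞 ℚ), v ∉ S₀ → ((3 : ℕ) : 𝓞 ℚ) ∉ v.asIdeal → W.HasGoodReductionAt v) ∧
            1 + ∑ v ∈ S₀, delta W 3 v =
              ∑ v ∈ S₀, ((if φ (Rat.HeightOneSpectrum.natGenerator v : ZMod m) =
                    (Rat.HeightOneSpectrum.natGenerator v : ZMod 3)
                  then sFactor 3 (Rat.HeightOneSpectrum.natGenerator v) else 0) +
                (if ψ (Rat.HeightOneSpectrum.natGenerator v : ZMod d) =
                    (Rat.HeightOneSpectrum.natGenerator v : ZMod 3)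
                  then sFactor 3 (Rat.HeightOneSpectrum.natGenerator v) else 0))) →
      ¬ (∃ (K : Type) (_ : Field K) (_ : NumberField K), IsImaginaryQuadratic K ∧
          SatisfiesHeegnerHypothesis (W.conductorNorm ℤ) K ∧ SatisfiesHeegnerHypothesis p K ∧
          Odd (NumberField.discr K) ∧ NumberField.discr K < -4 ∧
          (W.quadraticTwist (NumberField.discr K : ℚ)).analyticRank = 1 ∧
          ∃ (Wd : WeierstrassCurve ℚ) (_ : Wd.IsElliptic) (_ : Wd.IsGloballyMinimal),
            (∃ C : VariableChange ℚ, C • Wd = W.quadraticTwist (NumberField.discr K : ℚ)) ∧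
            ∃ (K'' : Type) (_ : Field K'') (_ : NumberField K''), IsImaginaryQuadratic K'' ∧
              Odd (NumberField.discr K'') ∧ NumberField.discr K'' < -4 ∧
              SatisfiesHeegnerHypothesis (Wd.conductorNorm ℤ) K'' ∧ SatisfiesHeegnerHypothesis p K'' ∧
              (Wd.quadraticTwist (NumberField.discr K'' : ℚ)).entireLFunction 1 ≠ 0 ∧
              ∃ (W'' : WeierstrassCurve ℚ) (_ : W''.IsElliptic) (_ : W''.IsGloballyMinimal),
                (∃ C : VariableChange ℚ, C • W'' = Wd.quadraticTwist (NumberField.discr K'' : ℚ)) ∧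
                ∃ q : ℚ, shaAn W'' = (q : ℂ) ∧ padicValRat p q = 0) →
      ∃ (K : Type) (_ : Field K) (_ : NumberField K), IsImaginaryQuadratic K ∧
        SatisfiesHeegnerHypothesis (W.conductorNorm ℤ) K ∧ SatisfiesHeegnerHypothesis p K ∧
        Odd (NumberField.discr K) ∧ NumberField.discr K < -4 ∧
        (W.quadraticTwist (NumberField.discr K : ℚ)).analyticRank = 1 ∧
        ∀ (Wd : WeierstrassCurve ℚ) [Wd.IsElliptic] [Wd.IsGloballyMinimal],
          (∃ C : VariableChange ℚ, C • Wd = W.quadraticTwist (NumberField.discr K : ℚ)) →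
          MissingUpperBoundAt Wd p) :
    Summit.BirchSwinnertonDyer.BirchSwinnertonDyer.Theses.EisensteinPrimes.MazurMCOnCellB :=
  EisensteinPrimesMazurMCOnCellBOfNamedFacts.mazurMCOnCellB_of_namedFacts_of_upperPartnerOffSubrow hP hDis hMaz hH hF
    h311 hDGZ hNHT hD (upperPartnerOffSubrow_of_noUnitEnd hP hW21 hH hF hMaz hD hNoUE)

end Summit.BirchSwinnertonDyer.BirchSwinnertonDyer.Theorems.EisensteinPrimesMazurMCOnCellBOfNamedFactsV7

end
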